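import Literature.AnabelianGeometry.SemiGraphs.OneVertexCuspsHypotheses
import Literature.AnabelianGeometry.SemiGraphs.WitnessIwahoriLoop
import HarnessLib

/-!
# A concrete semi-graph of anabelioids with `m` CUSPS AT ONE VERTEX, for every `m ≤ p`: the Iwahori vertex
# `P = ℤ_p ⋊ (1 + pℤ_p)` with the `p` pairwise estranged complements `T_c`, `c = 0, 1, …, m − 1`
# (instance of the generic brick `OneVertexCuspsHypotheses`; all clauses of [SemiAnbd] Prop. 3.6 / Thm. 3.7)

Mochizuki, *Semi-graphs of anabelioids*, Publ. RIMS **42** (2006) [SemiAnbd], §1 p. 11 (open edges), Def. 2.3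
pp. 24–25 (approximators), Def. 2.4 pp. 25–26 (elevated, slim, aloof / estranged), Prop. 3.6 p. 38, Thm. 3.7
p. 40. [cite: MochizukiSemiAnbd2006, Def 2.4 pp.25-26]

WITNESS file (abc-iut cell, layer L3, seat abc-iut-L3-t11 gen 6, step (B1′) of the row «NV-hLG@cusped» /
«CUSP-ABS·NONDEGENERATE-NV»; reuses abc-iut-w5-d236 / abc-iut-f-177's Iwahori group theory `WitnessIwahoriGroup`,
`WitnessIwahoriApprox`, `WitnessIwahoriLoop` BY NAME).  In `P = ℤ_p ⋊ (1 + pℤ_p)` the complements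
`T_c = {(c s, s)}` (`Iw.bHom c`, `c ∈ ℤ_p`) are conjugate exactly when `c ≡ c' (mod p)` (conjugation moves `T_{c'}`
to `T_{(1 + p s)c' − p a}`, `Iw.conj_mem_range_bHom`); hence:

* `Iw.range_bHom_inf_conj_eq_bot_of_sub_ne` — **estrangement across residues**: if `c − c' ∉ pℤ_p` then
  `T_c ∩ x T_{c'} x⁻¹ = 1` for EVERY `x ∈ P` (generalising the `{0, 1}` case `Iw.range_bHom_inf_conj_eq_bot_of_ne`);
* `multiCuspGraph p m` — the one-vertex semi-graph of anabelioids with vertex `P` and `m` cusps `e_j`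
  (`j : Fin m`) glued along `T_j` (`OneVertexCusps.graph`), and for `m ≤ p`:
  **`multiCuspGraph_thm37Hypotheses`** — it satisfies the hypotheses of Thm. 3.7 (estrangement law from the
  residues `0, …, m − 1` being distinct mod `p`; level family `LevelFamily.iw`; elevation datum = the translation
  subgroup of `P_M`, `IwMod.transl_inf_conj_range_brMod`); `exists_thm37Hypotheses_with_cusps` — for EVERY `m`
  some Thm-3.7 semi-graph of anabelioids has exactly the `m` open edges `Fin m` at its single vertex (take a
  prime `p ≥ m`).  The tree previously had at most ONE cusp per vertex (f-177's `cuspGraph`).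

A witness certifies consistency / non-vacuity only; it is not the special fibre of any curve; no statement of
the paper is touched; no instance, no notation, no `Prop` fact is declared.  Nothing here bears on
[IUTchIII] Cor. 3.12.
-/

noncomputable section

namespace Literature.AnabelianGeometry.SemiGraphs

open Literature.AlgebraicGeometry.Frobenioids (IsSlimGroup)

namespace Iw

open IwahoriWitness

variable {p : ℕ} [Fact p.Prime]

/-- **Estrangement across residues**: if `c − c'` is not divisible by `p` in `ℤ_p`, then `T_c ∩ x T_{c'} x⁻¹ = 1`
for every `x ∈ P` (conjugation by `x` carries `T_{c'}` to `T_{(1 + p x.s) c' − p x.a}`, and `T_c ∩ T_d = 1` for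
`c ≠ d`). [cite: MochizukiSemiAnbd2006, Def 2.4(iv) p.26] -/
theorem range_bHom_inf_conj_eq_bot_of_sub_ne {c c' : ℤ_[p]} (h : ∀ z : ℤ_[p], c - c' ≠ (p : ℤ_[p]) * z)
    (x : Iw p) :
    (bHom c).toMonoidHom.range ⊓ ((bHom c').toMonoidHom.range.map (MulAut.conj x).toMonoidHom) = ⊥ := by
  rw [eq_bot_iff]
  rintro z ⟨hz, ⟨y, hy, rfl⟩⟩
  rw [Subgroup.mem_bot]
  refine eq_one_of_mem_range_bHom_of_mem ?_ hz (conj_mem_range_bHom c' x y hy)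
  intro heq
  apply h (x.s * c' - x.a)
  unfold w at heq
  linear_combination heq

/-- Distinct residues `j ≠ j'` below `p` differ by a non-multiple of `p` in `ℤ_p`.
[cite: MochizukiSemiAnbd2006, Def 2.4(iv) p.26] -/
theorem natCast_sub_natCast_ne_p_mul {j j' : ℕ} (hj : j < p) (hj' : j' < p) (hne : j ≠ j') (z : ℤ_[p]) :
    (j : ℤ_[p]) - (j' : ℤ_[p]) ≠ (p : ℤ_[p]) * z := by
  intro h
  have hnorm : ‖(((j : ℤ) - (j' : ℤ) : ℤ) : ℤ_[p])‖ < 1 := by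
    have hcast : (((j : ℤ) - (j' : ℤ) : ℤ) : ℤ_[p]) = (j : ℤ_[p]) - (j' : ℤ_[p]) := by push_cast; ring
    rw [hcast, h]
    exact IwahoriWitness.norm_p_mul_lt_one p z
  rw [PadicInt.norm_int_lt_one_iff_dvd] at hnorm
  have hzero : ((j : ℤ) - (j' : ℤ)) = 0 := by
    refine Int.eq_zero_of_dvd_of_natAbs_lt_natAbs hnorm ?_
    simp only [Int.natAbs_natCast]
    omega
  exact hne (by omega)

end Iw

namespace IwahoriWitness

open ProfiniteSemiGraph

variable (p : ℕ) [Fact p.Prime]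

/-- **The witness `multiCuspGraph p m`**: one vertex with group `P = ℤ_p ⋊ (1 + pℤ_p)` and `m` open edges `e_j`,
`j : Fin m`, each with edge group `U = 1 + pℤ_p` glued along the complement `T_j` (`Iw.bHom j`).
[cite: MochizukiSemiAnbd2006, Def 2.1 p.22] -/
def multiCuspGraph (m : ℕ) : ProfiniteSemiGraph.{0} :=
  OneVertexCusps.graph (ι := Fin m) (Iw p) (fun _ => IwU p) fun j => Iw.bHom ((j : ℕ) : ℤ_[p])

/-- Every edge of `multiCuspGraph p m` is a cusp (open edge of verticial cardinality `1`).
[cite: MochizukiSemiAnbd2006, §1 p.12] -/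
theorem multiCuspGraph_isOpenEdge (m : ℕ) (e : (multiCuspGraph p m).graph.Edge) :
    (multiCuspGraph p m).graph.IsOpenEdge e :=
  (OneVertexCusps.semiGraph_isOpenEdge e).2

/-- The reduction of `T_c` at level `n` is the branch image of the level-`n` approximator:
`(P ↠ P_n) ∘ b_c = b̄_{c mod pⁿ} ∘ (U ↠ U_n)`. [cite: MochizukiSemiAnbd2006, Def 2.3(i) p.24] -/
theorem toMod_comp_bHom (n : ℕ) (c : ℤ_[p]) :
    (Iw.toMod n).comp (Iw.bHom (p := p) c).toMonoidHom =
      (IwMod.brMod (PadicInt.toZModPow n c)).comp (IwU.toMod n) := by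
  ext x
  · change PadicInt.toZModPow n (c * x.s) = PadicInt.toZModPow n c * PadicInt.toZModPow n x.s
    rw [map_mul]
  · rfl

/-- Hence the image of `T_c` in `P_n` is the range of `b̄_{c mod pⁿ}`. [cite: MochizukiSemiAnbd2006, Def 2.3(i) p.24] -/
theorem range_toMod_comp_bHom (n : ℕ) (c : ℤ_[p]) :
    ((Iw.toMod n).comp (Iw.bHom (p := p) c).toMonoidHom).range = (IwMod.brMod (PadicInt.toZModPow n c)).range := by
  rw [toMod_comp_bHom, MonoidHom.range_comp, MonoidHom.range_eq_top.mpr (IwU.toMod_surjective n),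
    ← MonoidHom.range_eq_map]

/-- **The ELEVATION DATUM of `P` against all complements**: at level `M` the translation subgroup of `P_M` has
order `p^M ≥ M` and meets no conjugate of the image of any `T_c`. [cite: MochizukiSemiAnbd2006, Def 2.4(i) p.25] -/
theorem iw_elevationDatum {ι : Type} (c : ι → ℤ_[p]) (M : ℕ) :
    ∃ (F : Type) (_ : Group F) (_ : Finite F) (π : Iw p →* F),
      IsOpen (π.ker : Set (Iw p)) ∧ Function.Surjective π ∧ ∃ S : Subgroup F, M ≤ Nat.card S ∧
        ∀ (k : ι) (g : F),
          S ⊓ ((π.comp (Iw.bHom (c k)).toMonoidHom).range.map (MulAut.conj g).toMonoidHom) = ⊥ := by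
  refine ⟨IwMod p M, inferInstance, inferInstance, Iw.toMod M, Iw.isOpen_ker_toMod M, Iw.toMod_surjective M,
    IwMod.transl, ?_, fun k g => ?_⟩
  · rw [IwMod.card_transl]
    exact (Nat.lt_pow_self (Fact.out : p.Prime).one_lt).le
  · rw [range_toMod_comp_bHom]
    exact IwMod.transl_inf_conj_range_brMod _ g

/-- **`multiCuspGraph p m` satisfies the hypotheses of [SemiAnbd] Thm. 3.7 for every `m ≤ p`** — the generic
brick `OneVertexCusps.thm37Hypotheses` fed with: `P` slim (`isSlimGroup_Iw`), the level family `LevelFamily.iw`,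
injective `b_c` with infinite `U`, the estrangement law (same cusp: malnormality `Iw.range_bHom_inf_conj_eq_bot_of_not_mem`;
distinct cusps `j ≠ j'`: residues distinct mod `p`, `Iw.range_bHom_inf_conj_eq_bot_of_sub_ne`), and the elevation
datum `iw_elevationDatum`. [cite: MochizukiSemiAnbd2006, Thm 3.7 p.40] -/
theorem multiCuspGraph_thm37Hypotheses (m : ℕ) (hm : m ≤ p) : (multiCuspGraph p m).Thm37Hypotheses := by
  refine OneVertexCusps.thm37Hypotheses (LevelFamily.iw p) (isSlimGroup_Iw p) (fun j => Iw.bHom_injective _)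
    (fun _ => inferInstance) ?_ (iw_elevationDatum p (fun j : Fin m => ((j : ℕ) : ℤ_[p])))
  intro k k' g hg
  by_cases hkk : k' = k
  · subst hkk
    exact Iw.range_bHom_inf_conj_eq_bot_of_not_mem _ (hg.resolve_left fun hne => hne rfl)
  · exact Iw.range_bHom_inf_conj_eq_bot_of_sub_ne
      (Iw.natCast_sub_natCast_ne_p_mul (lt_of_lt_of_le k.2 hm) (lt_of_lt_of_le k'.2 hm)
        fun heq => hkk (Fin.ext heq).symm) g

/-- **Non-vacuity with ANY finite number of cusps**: for every `m` there is a semi-graph of anabelioids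
satisfying the hypotheses of [SemiAnbd] Thm. 3.7 whose open edges are exactly `Fin m`, all at its single
vertex (take a prime `p ≥ m` and `multiCuspGraph p m`). [cite: MochizukiSemiAnbd2006, Thm 3.7 p.40] -/
theorem exists_thm37Hypotheses_with_cusps (m : ℕ) :
    ∃ 𝒢 : ProfiniteSemiGraph.{0}, 𝒢.graph.Edge = Fin m ∧ Nonempty (Unique 𝒢.graph.Vertex) ∧
      (∀ e : 𝒢.graph.Edge, 𝒢.graph.IsOpenEdge e) ∧ 𝒢.Thm37Hypotheses := by
  obtain ⟨q, hmq, hq⟩ := Nat.exists_infinite_primes m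
  haveI : Fact q.Prime := ⟨hq⟩
  exact ⟨multiCuspGraph q m, rfl, ⟨inferInstanceAs (Unique PUnit)⟩, multiCuspGraph_isOpenEdge q m,
    multiCuspGraph_thm37Hypotheses q m hmq⟩

end IwahoriWitness

end Literature.AnabelianGeometry.SemiGraphs

end
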